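import Literature.IUT.HodgeArakelov.LabelClassesOfCuspsHomogeneousCount
import HarnessLib

/-!
# [IUTchII] Def 2.3 (iii): counting `±`-label classes of cusps at a GENERAL level `Π_⊆ ⊆ Π_⊇` — `|LabCusp^±(Π_⊆)|` as an index inside a
# subgroup `R` normalising `Π_⊇`, for an `R`-homogeneous cuspidal datum

S. Mochizuki, *Inter-universal Teichmüller theory II*, kurims manuscript (Dec. 2020), §2 Def 2.3 (iii) p. 68 («for `Π_⊆ ⊆ Π_⊇` as above
[`Π_v ⊆ Π^±_v`, `Π^±_v ⊆ Π^±_v`, `Π̂_v ⊆ Π̂^±_v`, `Π̂^±_v ⊆ Π̂^±_v`] … a `±`-label class of cusps of `Π_⊆` … `LabCusp^±(Π_⊆)`»)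
[claim: Mochizuki2012, status: disputed] (IUTchII §2 Def 2.3 (iii), kurims p.68) (D-0012 claim key; record-only; nothing printed is asserted here).

abc-iut cell, seat abc-iut-w5-d132 (gen 6), row «DEF23iii-CARD-V» part 1 (sequel to p447018 / p452528, which treat the level `Π_⊆ = Π_⊇ = Π̂^±_v`).
PROOF-ONLY, PURE GROUP THEORY over abc-iut-L6-t1's interface (`CuspidalInertiaData`, `labelRel`, `LabCuspPM`; no `def`, no instance, no named
fact).  The LEVEL-GENERAL version of the count, needed for `Π_⊆ = Π_v ⊆ Π_⊇ = Π^±_v` (the first conjunct «`|LabCusp^±(Π_v)| = l`» of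
abc-iut-w5-d243's `def23_structuresConj_iff_card`, i.e. the existence of Def 2.3 (iii)'s `LabCuspStructure` by abc-iut-w5-d028's
`nonempty_iff_nonempty_equiv`), where everything happens inside the TEMPERED group `R = Π^cor_v = ι(Π^tp_C)` (which normalises `Π_⊇ = Π^±_v`
but is not all of `Π̂^cor_v`):

* `normalizerMap_conj_smul_of` — `N_{Π_⊇}(q J₀ q⁻¹) = q (N(J₀) ∩ Π_⊇) q⁻¹` for `q` normalising `Π_⊇`;
* `labelRel_conj_smul_iff_of` — for `a, b ∈ R` (`Π_⊇ ≤ R`, `R` normalising `Π_⊇`): `a J₀ a⁻¹ ~ b J₀ b⁻¹` iff `a⁻¹ b ∈ Π_⊇ · N(N(J₀) ∩ Π_⊇)`;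
* **`card_labCuspPM_level_eq_index`** — if the cuspidal groups of `Π_⊆` are EXACTLY the `R`-conjugates of one `J₀ ≤ Π_⊆`, then
  `|LabCusp^±(Π_⊆)| = [R : (N(N(J₀) ∩ Π_⊇) ∩ R) · Π_⊇]` (orbit–stabiliser inside `R`);
* **`card_labCuspPM_level_eq_l_of_inputs`** — the count `= l` from: `[R : Π_⊇] = 2l`, a subgroup `Π_X` with `[R : R ∩ Π_X] = 2` containing `Π_⊇`,
  `D ≤ Π_⊇` normalising `J₀` with SEPARATION `N(J₀) ∩ Π_X ∩ R ≤ D` (at the tempered level this is [SemiAnbd] Thm 6.5 (ii), not a profinite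
  fact), `J₀` stable under `N_R(D)`, and an inversion `q₁ ∈ R ∖ Π_X` normalising `D` — the arithmetic `2l / 2 = l` of p447018 inside `R`.

HONEST LABEL: kernel theorems about the typed interface; inputs are explicit binders discharged / named at the genuine tower in the companion
(tempered instance).  No side taken on [IUTchIII] Cor 3.12; typed ≠ proved; nothing here asserts abc.
-/

noncomputable section

open scoped Pointwise
open Literature.AnabelianGeometry.EtaleTheta (normalizer_conj_smul)

namespace Literature.IUT.HodgeArakelov

universe u

variable {S : BadPlaceSetting.{u}} {P : TopGroup.{u}} {T : TemperedCoverings S P} {W : PlusMinusTower T}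
variable {C : CuspidalInertiaData W} {Qsub Qsup R : Subgroup W.Corhat} {J₀ : Subgroup W.Corhat}

/-! ## 1. The label relation between conjugates, at a general level -/

/-- For `q` normalising `Π_⊇` and `J₀ ≤ Π_⊇`: the normaliser of `q J₀ q⁻¹` in `Π_⊇` (pushed into `Π̂^cor_v`) is `q · (N(J₀) ∩ Π_⊇) · q⁻¹`.
[claim: Mochizuki2012, status: disputed] (IUTchII §2 Def 2.3 (iii), kurims p.68) -/
theorem normalizerMap_conj_smul_of (hJ₀ : J₀ ≤ Qsup) {q : W.Corhat} (hq : MulAut.conj q • Qsup = Qsup) :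
    (Subgroup.normalizer ((((MulAut.conj q • J₀).subgroupOf Qsup : Subgroup Qsup)) : Set Qsup)).map Qsup.subtype =
      MulAut.conj q • (Subgroup.normalizer (J₀ : Set W.Corhat) ⊓ Qsup) := by
  have hle : MulAut.conj q • J₀ ≤ Qsup := (Subgroup.pointwise_smul_le_pointwise_smul_iff.mpr hJ₀).trans_eq hq
  rw [normalizerMap_eq Qsup hle, normalizer_conj_smul, Subgroup.smul_inf, hq]

/-- **The label relation between two `R`-conjugates of `J₀`, as a COSET condition inside `R`** (`Π_⊇ ≤ R`, `R` normalising `Π_⊇`,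
`J₀ ≤ Π_⊇`): `a J₀ a⁻¹ ~ b J₀ b⁻¹` (normalisers in `Π_⊇` are `Π_⊇`-conjugate) iff `a⁻¹ b = p · n` with `p ∈ Π_⊇`, `n ∈ N(N(J₀) ∩ Π_⊇)`.
[claim: Mochizuki2012, status: disputed] (IUTchII §2 Def 2.3 (iii), kurims p.68) -/
theorem labelRel_conj_smul_iff_of (hJ₀ : J₀ ≤ Qsup) (hRQ : ∀ r ∈ R, MulAut.conj r • Qsup = Qsup) {a b : W.Corhat}
    (haR : a ∈ R) (hbR : b ∈ R)
    (ha : C.IsCuspidalInertia Qsub (MulAut.conj a • J₀)) (hb : C.IsCuspidalInertia Qsub (MulAut.conj b • J₀)) :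
    labelRel C Qsub Qsup ⟨_, ha⟩ ⟨_, hb⟩ ↔
      ∃ p ∈ Qsup, ∃ n ∈ Subgroup.normalizer ((Subgroup.normalizer (J₀ : Set W.Corhat) ⊓ Qsup : Subgroup W.Corhat) : Set W.Corhat),
        a⁻¹ * b = p * n := by
  set N₀ : Subgroup W.Corhat := Subgroup.normalizer (J₀ : Set W.Corhat) ⊓ Qsup with hN₀
  change (∃ g ∈ Qsup, _ = _) ↔ _
  simp only [normalizerMap_conj_smul_of hJ₀ (hRQ a haR), normalizerMap_conj_smul_of hJ₀ (hRQ b hbR), ← conj_smul_eq_map_conj]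
  constructor
  · rintro ⟨g, hg, hN⟩
    refine ⟨a⁻¹ * g * a, ?_, (g * a)⁻¹ * b, ?_, by group⟩
    · -- `a⁻¹ g a ∈ Π_⊇` since `a⁻¹` normalises `Π_⊇`
      have h := hRQ a⁻¹ (R.inv_mem haR)
      rw [← h]
      exact ⟨g, hg, by simp⟩
    · rw [mem_normalizer_iff_conj_smul_eq, map_mul, mul_smul, map_inv, inv_smul_eq_iff, hN, ← mul_smul, ← map_mul]
  · rintro ⟨p, hp, n, hn, hab⟩
    refine ⟨a * p * a⁻¹, ?_, ?_⟩
    · have h := hRQ a haR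
      rw [← h]
      exact ⟨p, hp, rfl⟩
    · have hb' : b = a * p * a⁻¹ * a * n := by
        rw [inv_mul_cancel_right, mul_assoc, ← hab, mul_inv_cancel_left]
      rw [mem_normalizer_iff_conj_smul_eq] at hn
      rw [hb', map_mul, mul_smul, hn, ← mul_smul, ← map_mul, inv_mul_cancel_right]

/-! ## 2. The count inside `R` -/

/-- `Π_⊇ ∩ R` is normal in `R` when `R` normalises `Π_⊇`. [claim: Mochizuki2012, status: disputed] (IUTchII §2 Def 2.3 (iii), kurims p.68) -/
theorem normal_subgroupOf_of_conj_smul_eq (hRQ : ∀ r ∈ R, MulAut.conj r • Qsup = Qsup) : (Qsup.subgroupOf R).Normal := by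
  refine ⟨fun x hx r => ?_⟩
  rw [Subgroup.mem_subgroupOf] at hx ⊢
  have h := hRQ r r.2
  change (r : W.Corhat) * x * (r : W.Corhat)⁻¹ ∈ Qsup
  rw [← h]
  exact ⟨x, hx, rfl⟩

/-- **`|LabCusp^±(Π_⊆)|` AS AN INDEX INSIDE `R`** for an `R`-homogeneous datum at the level `Π_⊆ ⊆ Π_⊇` (`J₀ ≤ Π_⊆`... ≤ `Π_⊇ ≤ R`, `R` normalising `Π_⊇`):
if the cuspidal groups of `Π_⊆` are exactly the `R`-conjugates of `J₀`, then `r ↦ ⟦r J₀ r⁻¹⟧` identifies `LabCusp^±(Π_⊆)` with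
`R / ((N(N(J₀) ∩ Π_⊇) ∩ R) · (Π_⊇ ∩ R))`. [claim: Mochizuki2012, status: disputed] (IUTchII §2 Def 2.3 (iii), kurims p.68) -/
theorem card_labCuspPM_level_eq_index (hJ₀ : J₀ ≤ Qsup) (hQR : Qsup ≤ R) (hRQ : ∀ r ∈ R, MulAut.conj r • Qsup = Qsup)
    (hC : ∀ J, C.IsCuspidalInertia Qsub J ↔ ∃ r ∈ R, J = MulAut.conj r • J₀) :
    Nat.card (LabCuspPM C Qsub Qsup) =
      ((Subgroup.normalizer ((Subgroup.normalizer (J₀ : Set W.Corhat) ⊓ Qsup : Subgroup W.Corhat) : Set W.Corhat)).subgroupOf R ⊔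
        Qsup.subgroupOf R).index := by
  haveI := normal_subgroupOf_of_conj_smul_eq hRQ
  set N₂ : Subgroup W.Corhat :=
    Subgroup.normalizer ((Subgroup.normalizer (J₀ : Set W.Corhat) ⊓ Qsup : Subgroup W.Corhat) : Set W.Corhat) with hN₂
  set Sg : Subgroup R := N₂.subgroupOf R ⊔ Qsup.subgroupOf R with hSg
  have hcusp : ∀ q : R, C.IsCuspidalInertia Qsub (MulAut.conj (q : W.Corhat) • J₀) := fun q => (hC _).mpr ⟨q, q.2, rfl⟩
  let f : R → LabCuspPM C Qsub Qsup := fun q => Quot.mk _ ⟨MulAut.conj (q : W.Corhat) • J₀, hcusp q⟩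
  have hf : ∀ a b : R, f a = f b ↔ a⁻¹ * b ∈ Sg := by
    intro a b
    rw [hSg, mem_sup_normal_iff]
    refine (labCuspPM_mk_eq_mk_iff C Qsub Qsup _ _).trans
      ((labelRel_conj_smul_iff_of hJ₀ hRQ a.2 b.2 (hcusp a) (hcusp b)).trans ?_)
    constructor
    · rintro ⟨p, hp, n, hn, hab⟩
      have hpR : p ∈ R := hQR hp
      have hnR : n ∈ R := by
        have : n = p⁻¹ * ((a : W.Corhat)⁻¹ * b) := by rw [hab, inv_mul_cancel_left]
        rw [this]
        exact R.mul_mem (R.inv_mem hpR) (R.mul_mem (R.inv_mem a.2) b.2)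
      refine ⟨⟨p, hpR⟩, ?_, ⟨n, hnR⟩, ?_, Subtype.ext hab⟩
      · rw [Subgroup.mem_subgroupOf]; exact hp
      · rw [Subgroup.mem_subgroupOf]; exact hn
    · rintro ⟨p, hp, n, hn, hab⟩
      rw [Subgroup.mem_subgroupOf] at hp hn
      exact ⟨p, hp, n, hn, congrArg Subtype.val hab⟩
  have hfs : Function.Surjective f := by
    intro t
    induction t using Quot.ind with
    | mk J =>
      obtain ⟨q, hq, hJ⟩ := (hC J.1).mp J.2
      exact ⟨⟨q, hq⟩, congrArg (Quot.mk _) (Subtype.ext hJ.symm)⟩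
  let F : R ⧸ Sg → LabCuspPM C Qsub Qsup := fun x =>
    Quotient.liftOn' x f fun a b hab => (hf a b).mpr (QuotientGroup.leftRel_apply.mp hab)
  have hF : ∀ q, F (QuotientGroup.mk q) = f q := fun _ => rfl
  have hFbij : Function.Bijective F := by
    constructor
    · intro x y hxy
      obtain ⟨a, rfl⟩ := QuotientGroup.mk_surjective x
      obtain ⟨b, rfl⟩ := QuotientGroup.mk_surjective y
      rw [hF, hF, hf] at hxy
      exact QuotientGroup.eq.mpr hxy
    · intro t
      obtain ⟨q, rfl⟩ := hfs t
      exact ⟨QuotientGroup.mk q, hF q⟩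
  rw [Subgroup.index_eq_card, Nat.card_congr (Equiv.ofBijective F hFbij)]

/-- **THE LEVEL-GENERAL COUNT `|LabCusp^±(Π_⊆)| = l` FROM ITS GROUP-THEORETIC INPUTS, inside `R`.**  `R`-homogeneous datum at `Π_⊆ ⊆ Π_⊇ ≤ R`
(`R` normalising `Π_⊇`), `[R : Π_⊇] = 2l`, a subgroup `Π_X ⊇ Π_⊇` with `[R : R ∩ Π_X] = 2`, `D ≤ Π_⊇` normalising `J₀` with SEPARATION
`N(J₀) ∩ Π_X ∩ R ≤ D` and `J₀` stable under every `r ∈ R` normalising `D`, and an inversion `q₁ ∈ R ∖ Π_X` normalising `D`.  Then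
`|LabCusp^±(Π_⊆)| = 2l / 2 = l`. [claim: Mochizuki2012, status: disputed] (IUTchII §2 Def 2.3 (iii), kurims p.68) -/
theorem card_labCuspPM_level_eq_l_of_inputs (hJ₀ : J₀ ≤ Qsup) (hQR : Qsup ≤ R) (hRQ : ∀ r ∈ R, MulAut.conj r • Qsup = Qsup)
    (hC : ∀ J, C.IsCuspidalInertia Qsub J ↔ ∃ r ∈ R, J = MulAut.conj r • J₀)
    {Xh D : Subgroup W.Corhat} (hXh : (Xh.subgroupOf R).index = 2) (hPX : Qsup ≤ Xh) (hDP : D ≤ Qsup)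
    (hDJ : D ≤ Subgroup.normalizer (J₀ : Set W.Corhat)) (hsep : Subgroup.normalizer (J₀ : Set W.Corhat) ⊓ Xh ⊓ R ≤ D)
    (hJD : ∀ r ∈ R, MulAut.conj r • D = D → MulAut.conj r • J₀ = J₀)
    {q₁ : W.Corhat} (hq₁R : q₁ ∈ R) (hq₁X : q₁ ∉ Xh) (hq₁D : MulAut.conj q₁ • D = D) (hidx : (Qsup.subgroupOf R).index = 2 * S.l) :
    Nat.card (LabCuspPM C Qsub Qsup) = S.l := by
  haveI := normal_subgroupOf_of_conj_smul_eq hRQ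
  haveI : (Xh.subgroupOf R).Normal := Subgroup.normal_of_index_eq_two hXh
  -- (1) `N(J₀) ∩ Π_⊇ = D`
  have hN₀ : Subgroup.normalizer (J₀ : Set W.Corhat) ⊓ Qsup = D :=
    le_antisymm (fun q hq => hsep ⟨⟨hq.1, hPX hq.2⟩, hQR hq.2⟩) (le_inf hDJ hDP)
  rw [card_labCuspPM_level_eq_index hJ₀ hQR hRQ hC, hN₀]
  set N₂ : Subgroup R := (Subgroup.normalizer (D : Set W.Corhat)).subgroupOf R with hN₂
  set XR : Subgroup R := Xh.subgroupOf R with hXR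
  set QR : Subgroup R := Qsup.subgroupOf R with hQR'
  have hPX' : QR ≤ XR := fun q hq => by
    rw [hQR', Subgroup.mem_subgroupOf] at hq
    rw [hXR, Subgroup.mem_subgroupOf]
    exact hPX hq
  -- (2) `N_R(D) ∩ Π_X ≤ Π_⊇`
  have hN₂X : N₂ ⊓ XR ≤ QR := by
    intro q hq
    obtain ⟨hqD, hqX⟩ := Subgroup.mem_inf.mp hq
    rw [hN₂, Subgroup.mem_subgroupOf] at hqD
    rw [hXR, Subgroup.mem_subgroupOf] at hqX
    rw [hQR', Subgroup.mem_subgroupOf]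
    have hqJ : MulAut.conj (q : W.Corhat) • J₀ = J₀ := hJD q q.2 (mem_normalizer_iff_conj_smul_eq.mp hqD)
    exact hDP (hsep ⟨⟨mem_normalizer_iff_conj_smul_eq.mpr hqJ, hqX⟩, q.2⟩)
  have hinf : QR ⊓ N₂ = XR ⊓ N₂ :=
    le_antisymm (inf_le_inf_right _ hPX') (le_inf (fun q hq => hN₂X ⟨hq.2, hq.1⟩) inf_le_right)
  -- (3) `[N_R(D) · Π_⊇ : Π_⊇] = [N_R(D) : N_R(D) ∩ Π_X] = 2`
  have hq₁N : (⟨q₁, hq₁R⟩ : R) ∈ N₂ := by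
    rw [hN₂, Subgroup.mem_subgroupOf]
    exact mem_normalizer_iff_conj_smul_eq.mpr hq₁D
  have hq₁X' : (⟨q₁, hq₁R⟩ : R) ∉ XR := fun h => hq₁X (by rw [hXR, Subgroup.mem_subgroupOf] at h; exact h)
  have h2 : XR.relIndex N₂ = 2 := by
    have hdvd : XR.relIndex N₂ ∣ 2 := hXh ▸ Subgroup.relIndex_dvd_index_of_normal XR N₂
    rcases (Nat.dvd_prime Nat.prime_two).mp hdvd with h1 | h2
    · exact absurd (Subgroup.relIndex_eq_one.mp h1 hq₁N) hq₁X'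
    · exact h2
  have hrel : QR.relIndex (N₂ ⊔ QR) = 2 := by
    rw [Subgroup.relIndex_sup_right, ← Subgroup.inf_relIndex_right, hinf, Subgroup.inf_relIndex_right, h2]
  -- (4) `2l = [R : Π_⊇] = [R : N_R(D) · Π_⊇] · 2`
  have hmul := Subgroup.relIndex_mul_index (le_sup_right : QR ≤ N₂ ⊔ QR)
  rw [hrel, hidx] at hmul
  exact Nat.eq_of_mul_eq_mul_left two_pos hmul

end Literature.IUT.HodgeArakelov

end
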